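import Literature.AlgebraicGeometry.Motives.MotivatedCycles
import Literature.AlgebraicGeometry.Motives.CorrespondencesCompProofs
import HarnessLib

/-!
# Motivated classes are stable under push-forward along projections (André 1996, Prop. 2.1 (ii))

Topic `Literature/AlgebraicGeometry/Motives`; ONE named fact (result in print, `def … : Prop`,
D-0014) requested by `wi-10053` for route `HodgeConjecture/MomentAmplification` (support item
`Amplification`, the `N = 1` extraction `v = deg⁻¹ · pr₁₊ (pr₁* v ∪ pr₂* η^{n−p} ∪ pr₂* ηᵖ)`),
completing the `f^*, f_*` formalism of André's motivated classes in the tree: cup products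
(`WeilCohomology.motivatedClasses_cup_le`, Prop. 2.1 (i)), pull-backs
(`WeilCohomology.motivatedClasses_map_pullback_le`, Prop. 2.1 (ii) first inclusion and p. 15),
and now push-forwards along projections (Prop. 2.1 (ii), second inclusion).

Y. André, *Pour une théorie inconditionnelle des motifs*, Publ. Math. IHÉS 83 (1996), §2.1
(held, read pp. 14–15): **Proposition 2.1.** — (i) `A_mot(X)_E` est une sous-`E`-algèbre de
`H•(X)`; (ii) On a `pr_X^* A_mot(X)_E ⊆ A_mot(X × Z)_E` et `pr_{X*}(A_mot(X × Z)_E) ⊆ A_mot(X)_E`.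
Proof of the second inclusion (p. 15): «On a, d'autre part,
`pr^{XZ}_{X*} pr^{XZY}_{XZ*} (α ∪ ⋆β) = pr^{XZY}_{X*} (α ∪ ⋆β)`» — a motivated class on `X × Z`
with auxiliary variety `Y` pushes forward to the motivated class on `X` with auxiliary variety
`Z × Y` (functoriality of push-forward). The general `f_*` is then obtained «en composant les
correspondances motivées avec la classe du graphe de `f` ou sa transposée» (p. 15, after the
Corollaire), with the projection formula `f_*(a ∪ f^* b) = f_*(a) ∪ b`.

## Contents

* `WeilCohomology.motivatedClasses_map_pushforward_fst_le` — the named fact, for the tree's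
  motivated classes `W.motivatedClasses` (`MotivatedCycles.lean`) and the tree's push-forward
  `W.pushforward hX (fst X Y)` (`CorrespondencesCompProofs.lean`: the Poincaré-duality adjoint of
  `pr_X^*`, `tr_X (pr_{X*} z ∪ y) = tr_{X×Y} (z ∪ pr_X^* y)`, `trace_cup_pushforward`):
  `pr_{X*} A_mot^c(X × Y) ⊆ A_mot^p(X)` (`2c + d' = 2(n + m)`, `2p + d' = 2n`, i.e. `c = p + m`).
* PROVED from it: the pointwise form `pushforward_fst_mem_motivatedClasses` and the relational
  form `mem_motivatedClasses_of_projectionFormula` — a class `x ∈ H²ᵖ(X)` satisfying the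
  projection formula `tr_X (x ∪ y) = tr_{X×Y} (z ∪ pr_X^* y)` for all `y` against a motivated
  `z` is motivated (`x = pr_{X*} z` by perfectness of the Poincaré pairing) — the shape used by the
  consumer, whose `pr₁₊` is "characterised by the projection formula".

## Rendering choices / provability

* Unlike its two siblings this fact carries NO `HasHardLefschetz` / `HasProdHyperplaneClasses`
  hypothesis: the printed one-line proof transcribes to the tree's generators
  `W.IsMotivatedClass` (any hyperplane class of `(X × Y) × Z` as polarisation) by transporting
  the auxiliary data `(η, ⋆, α, β)` along the associativity isomorphism
  `(X × Y) × Z ≅ X × (Y × Z)` (a hyperplane class pulls back to a hyperplane class along an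
  isomorphism, Kleiman's `⋆` is transported by conjugation, rational algebraic classes by
  `pullback_ratAlgebraicClasses_le`, the trace is invariant by Künneth + `trace_externalCup`),
  then extending from generators to the span by linearity of `pr_{X*}`. No product polarisation
  enters. It is therefore derivable from the axioms of `WeilCohomology` (estimated L-sized:
  associator transport of `IsLefschetzStar` and of the trace); vendored as a fact for now.
* Degrees: as in `W.pushforward`, the complementary degree `d'` is a free natural number with
  the two degree equations; they force `c = p + m` and `d' = 2(n − p)`.
* Only the first projection `fst` is stated (the consumer's `pr₁`); the second follows by the
  braiding together with `motivatedClasses_map_pullback_le`.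

## References

* Y. André, *Pour une théorie inconditionnelle des motifs*, Publ. Math. IHÉS 83 (1996) 5–49:
  §2.1 Déf. 1, Prop. 2.1 (ii) (p. 14) and its proof (p. 15), the `f^*, f_*` paragraph after the
  Corollaire (p. 15); Thm. 0.3. [`Andre1996Motifs`]
* B. Kahn, *Zeta and L-functions of varieties and motives* (2020), §3.5.1 (push-forward as the
  Poincaré-duality adjoint). [`Kahn2020`]
-/

universe u v

open CategoryTheory AlgebraicGeometry MonoidalCategory CartesianMonoidalCategory

noncomputable section

namespace Literature.AlgebraicGeometry.Motives

namespace WeilCohomology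

variable {k : Type u} [Field k] {K : Type v} [Field K] [CharZero K] (W : WeilCohomology k K)

/-- **Motivated classes are stable under push-forward along projections** (André 1996, §2.1,
Prop. 2.1 (ii), second inclusion: `pr_{X*}(A_mot(X × Z)_E) ⊆ A_mot(X)_E`; proof p. 15:
`pr^{XZ}_{X*} pr^{XZY}_{XZ*}(α ∪ ⋆β) = pr^{XZY}_{X*}(α ∪ ⋆β)`; Thm. 0.3), transcribed for the tree's
`W.motivatedClasses` and the push-forward `W.pushforward hX (fst X Y)` (the adjoint of `pr_X^*`
for the Poincaré pairings, `trace_cup_pushforward`): for `X`, `Y` smooth projective of dimensions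
`n`, `m` and degrees `2c + d' = 2(n + m)`, `2p + d' = 2n` (so `c = p + m`),
`pr_{X*}` maps `A_mot^c(X × Y)` into `A_mot^p(X)`. Stated without `HasHardLefschetz` /
`HasProdHyperplaneClasses` (not needed by the printed proof, see the module docstring; derivable
from the axioms by associator transport, not yet done).
[cite: Andre1996Motifs, §2.1 Prop. 2.1 (ii) (p. 14, proof p. 15)] -/
def motivatedClasses_map_pushforward_fst_le : Prop :=
  ∀ ⦃n m : ℕ⦄ ⦃X Y : SchemeOver k⦄ (hX : IsSmoothProjective n X) (_ : IsSmoothProjective m Y)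
    ⦃p c d' : ℕ⦄ (he : 2 * c + d' = 2 * (n + m)) (hd : 2 * p + d' = 2 * n),
      (W.motivatedClasses (n + m) (X ⊗ Y) c).map (W.pushforward (N := n + m) hX (fst X Y) he hd) ≤
        W.motivatedClasses n X p

variable {W}
variable {n m : ℕ} {X Y : SchemeOver k}

/-- Pointwise form of `motivatedClasses_map_pushforward_fst_le` (André 1996, Prop. 2.1 (ii); the
named fact is the hypothesis `hpush`): `z ∈ A_mot^c(X × Y)` implies `pr_{X*} z ∈ A_mot^p(X)`.
[cite: Andre1996Motifs, §2.1 Prop. 2.1 (ii)] -/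
theorem pushforward_fst_mem_motivatedClasses (hpush : W.motivatedClasses_map_pushforward_fst_le)
    (hX : IsSmoothProjective n X) (hY : IsSmoothProjective m Y) {p c d' : ℕ}
    (he : 2 * c + d' = 2 * (n + m)) (hd : 2 * p + d' = 2 * n) {z : W.obj (X ⊗ Y) (2 * c)}
    (hz : z ∈ W.motivatedClasses (n + m) (X ⊗ Y) c) :
    W.pushforward (N := n + m) hX (fst X Y) he hd z ∈ W.motivatedClasses n X p :=
  hpush hX hY he hd (Submodule.mem_map_of_mem hz)

/-- **Relational form** (the consumer's shape: `pr₁₊` "characterised by the projection formula";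
André 1996, Prop. 2.1 (ii) with the projection formula of p. 15): if `z ∈ A_mot^c(X × Y)` and
`x ∈ H²ᵖ(X)` satisfies `tr_X (x ∪ y) = tr_{X×Y} (z ∪ pr_X^* y)` for every `y ∈ H^{2q}(X)`
(`p + q = n`, `c + q = n + m`), then `x ∈ A_mot^p(X)`: by perfectness of the Poincaré pairing
(`isPerfPair_cupPairing`) `x = pr_{X*} z`.
[cite: Andre1996Motifs, §2.1 Prop. 2.1 (ii) and p. 15 (projection formula)] -/
theorem mem_motivatedClasses_of_projectionFormula
    (hpush : W.motivatedClasses_map_pushforward_fst_le) (hX : IsSmoothProjective n X)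
    (hY : IsSmoothProjective m Y) {p q c : ℕ} (hpq : p + q = n) (hcq : c + q = n + m)
    {z : W.obj (X ⊗ Y) (2 * c)} (hz : z ∈ W.motivatedClasses (n + m) (X ⊗ Y) c)
    {x : W.obj X (2 * p)}
    (hproj : ∀ y : W.obj X (2 * q),
      W.cupPairing X n (2 * p) (2 * q) (by omega) x y =
        W.trace (X ⊗ Y) (n + m)
          (W.cup (show 2 * c + 2 * q = 2 * (n + m) by omega) z (W.pullback (fst X Y) (2 * q) y))) :
    x ∈ W.motivatedClasses n X p := by
  have he : 2 * c + 2 * q = 2 * (n + m) := by omega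
  have hd : 2 * p + 2 * q = 2 * n := by omega
  have hxz : x = W.pushforward (N := n + m) hX (fst X Y) he hd z := by
    haveI := W.isPerfPair_cupPairing hX (2 * p) (2 * q) hd
    refine (LinearMap.IsPerfPair.bijective_left (W.cupPairing X n (2 * p) (2 * q) hd)).1 ?_
    ext y
    rw [hproj y, PreWeilCohomology.cupPairing, LinearMap.compr₂_apply, W.trace_cup_pushforward]
  rw [hxz]
  exact pushforward_fst_mem_motivatedClasses hpush hX hY he hd hz

end WeilCohomology

end Literature.AlgebraicGeometry.Motives

end
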